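import Literature.MathematicalPhysics.QuantumManyBody.GroundStateFeynmanKacGaussian
import Literature.Analysis.Calculus.HardyPrimitive
import Mathlib.Probability.BrownianMotion.Basic
import Mathlib.MeasureTheory.Integral.MeanInequalities
import HarnessLib

/-!
# Route BECCutLineWeakDisorder — `WitnessTransfer`, one-dimensional occupation estimate I:
# generic tools (Paley–Zygmund, Gaussian density bounds, two-time correlation bound)

Support file (does not close the item) for item stmt-AtomisticToContinuum-14978
(`Summit.AtomisticToContinuum.BoseEinsteinCondensation.Theses.BECCutLineWeakDisorder`, decl
`WitnessTransfer`), stub (S2) `stub_oneDim_occupation_pz` of line `Sketch`: the second-moment /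
Paley–Zygmund lower bound for the occupation functional `∫₀ᵀ k_s(b_s) ds` of a one-dimensional
pre-Brownian motion. This file collects the generic ingredients, all in `ℝ≥0∞`:

* `lintegral_le_mul_measure_ge_of_sq_le` — Paley–Zygmund in the form
  `E Z ≤ 4 C · P(Z ≥ a)` whenever `E[Z²] ≤ C · E Z`, `2a ≤ E Z < ∞` (Cauchy–Schwarz);
* `lintegral_gaussianReal_le_peak_mul` — `∫ f dN(μ, v) ≤ (2πv)^{-1/2} ∫ f du`;
* `peak_mul_exp_neg_four_le_gaussianPDFReal`, `mul_lintegral_le_lintegral_gaussianReal_of_window` —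
  on the window `|u| ≤ 2√T`, `T/2 ≤ v ≤ T`, the density of `N(0, v)` is `≥ e^{-4} (2πT)^{-1/2}`;
* `lintegral_Ioc_peak` — `∫_{(0,T]} (2πu)^{-1/2} du = 2√T/√(2π)`, and the shifted window bound
  `lintegral_Ioc_indicator_shift_le`;
* `lintegral_mul_eval_le_of_lt` — for a pre-Brownian motion `b` and `s < t`,
  `E[f(b_s) g(b_t)] ≤ E[f(b_s)] · (2π(t−s))^{-1/2} ∫ g du` (independent Gaussian increment);
* `lintegral_sq_eq_two_mul_lintegral_indicator` — `(∫ φ dν)² = 2 ∫∫_{s<s'} φ(s)φ(s') dν dν` for a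
  measure `ν` on `ℝ` without atoms.

## References

* K. L. Chung, Z. Zhao, *From Brownian Motion to Schrödinger's Equation* (1995), §1.1–1.3
  (Gaussian transition density, Markov property). [ChungZhao1995]
-/

noncomputable section

open MeasureTheory ProbabilityTheory Filter Set Metric
open scoped ENNReal NNReal Topology

namespace Summit.AtomisticToContinuum.BoseEinsteinCondensation.Theorems.CutLineWitness

open Literature.MathematicalPhysics.QuantumManyBody.BoseGas
open Literature.Probability.Process

/-! ### Paley–Zygmund via Cauchy–Schwarz -/

/-- **Paley–Zygmund inequality** (`ℝ≥0∞` form). If `Z ≥ 0` is measurable on a probability space with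
`E[Z²] ≤ C · E Z`, `2a ≤ E Z` and `E Z < ∞`, then `E Z ≤ 4 C · P(a ≤ Z)`: indeed
`E Z ≤ a + E[Z 𝟙_{a ≤ Z}] ≤ a + (E[Z²] P(a ≤ Z))^{1/2}` by Cauchy–Schwarz. [folklore] -/
theorem lintegral_le_mul_measure_ge_of_sq_le {Ω : Type*} [MeasurableSpace Ω] (P : Measure Ω)
    [IsProbabilityMeasure P] {Z : Ω → ℝ≥0∞} (hZ : Measurable Z) {C a : ℝ≥0∞}
    (h2 : ∫⁻ ω, Z ω ^ 2 ∂P ≤ C * ∫⁻ ω, Z ω ∂P) (ha : 2 * a ≤ ∫⁻ ω, Z ω ∂P)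
    (hfin : ∫⁻ ω, Z ω ∂P ≠ ∞) :
    ∫⁻ ω, Z ω ∂P ≤ 4 * C * P {ω | a ≤ Z ω} := by
  set I := ∫⁻ ω, Z ω ∂P with hI
  set A := {ω | a ≤ Z ω} with hA
  have hAm : MeasurableSet A := measurableSet_le measurable_const hZ
  set S := (∫⁻ ω, Z ω ^ 2 ∂P) ^ (1 / 2 : ℝ) * P A ^ (1 / 2 : ℝ) with hS
  -- Cauchy–Schwarz on `A`, trivial bound on `Aᶜ`
  have hsplit : I ≤ a + S := by
    have h1 : I = ∫⁻ ω in A, Z ω ∂P + ∫⁻ ω in Aᶜ, Z ω ∂P := (lintegral_add_compl Z hAm).symm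
    have h2' : ∫⁻ ω in Aᶜ, Z ω ∂P ≤ a := by
      calc ∫⁻ ω in Aᶜ, Z ω ∂P ≤ ∫⁻ _ in Aᶜ, a ∂P :=
            setLIntegral_mono' hAm.compl fun ω hω => le_of_lt (not_le.1 hω)
        _ = a * P Aᶜ := setLIntegral_const _ _
        _ ≤ a * 1 := by gcongr; exact prob_le_one
        _ = a := mul_one a
    have h3 : ∫⁻ ω in A, Z ω ∂P ≤ S := by
      have e1 : ∫⁻ ω in A, Z ω ∂P = ∫⁻ ω, (Z * A.indicator (1 : Ω → ℝ≥0∞)) ω ∂P := by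
        rw [← lintegral_indicator hAm]
        refine lintegral_congr fun ω => ?_
        by_cases h : ω ∈ A <;> simp [h]
      have e2 : ∀ ω, (A.indicator (1 : Ω → ℝ≥0∞) ω) ^ (2 : ℝ) = A.indicator 1 ω := fun ω => by
        by_cases h : ω ∈ A <;> simp [h]
      rw [e1, hS]
      calc ∫⁻ ω, (Z * A.indicator (1 : Ω → ℝ≥0∞)) ω ∂P
          ≤ (∫⁻ ω, Z ω ^ (2 : ℝ) ∂P) ^ (1 / (2 : ℝ)) *
              (∫⁻ ω, (A.indicator 1 ω) ^ (2 : ℝ) ∂P) ^ (1 / (2 : ℝ)) :=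
            ENNReal.lintegral_mul_le_Lp_mul_Lq P Real.HolderConjugate.two_two hZ.aemeasurable
              ((measurable_one.indicator hAm).aemeasurable)
        _ = _ := by simp_rw [e2, lintegral_indicator_one hAm, ENNReal.rpow_two]
    rw [h1, add_comm]
    exact add_le_add h2' h3
  -- `I ≤ 2 S`
  have hI2S : I ≤ 2 * S := by
    have h := calc I + I = 2 * I := (two_mul I).symm
      _ ≤ 2 * (a + S) := by gcongr
      _ = 2 * a + 2 * S := mul_add _ _ _
      _ ≤ I + 2 * S := add_le_add ha le_rfl
    exact (ENNReal.add_le_add_iff_left hfin).1 h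
  have hS2 : S ^ 2 = (∫⁻ ω, Z ω ^ 2 ∂P) * P A := by
    rw [hS, mul_pow, ← ENNReal.rpow_two, ← ENNReal.rpow_two, ← ENNReal.rpow_mul,
      ← ENNReal.rpow_mul]
    norm_num
  have h4 : I * I ≤ I * (4 * C * P A) :=
    calc I * I = I ^ 2 := (sq I).symm
      _ ≤ (2 * S) ^ 2 := by gcongr
      _ = 4 * ((∫⁻ ω, Z ω ^ 2 ∂P) * P A) := by rw [mul_pow, hS2]; norm_num
      _ ≤ 4 * ((C * I) * P A) := by gcongr
      _ = I * (4 * C * P A) := by ring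
  rcases eq_or_ne I 0 with h0 | h0
  · rw [h0]; exact zero_le
  · exact (ENNReal.mul_le_mul_iff_right h0 hfin).1 h4

/-! ### Gaussian density bounds -/

/-- `∫ f dN(μ, v) ≤ (2πv)^{-1/2} · ∫ f du` (`v ≠ 0`): the Gaussian density is bounded by its peak.
[folklore] -/
theorem lintegral_gaussianReal_le_peak_mul (μ : ℝ) {v : ℝ≥0} (hv : v ≠ 0) (f : ℝ → ℝ≥0∞) :
    ∫⁻ x, f x ∂gaussianReal μ v ≤ ENNReal.ofReal ((√(2 * Real.pi * v))⁻¹) * ∫⁻ x, f x := by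
  rw [gaussianReal_of_var_ne_zero μ hv,
    lintegral_withDensity_eq_lintegral_mul_non_measurable _ (measurable_gaussianPDF μ v)
      (ae_of_all _ fun _ => gaussianPDF_lt_top) f,
    ← lintegral_const_mul' _ _ ENNReal.ofReal_ne_top]
  refine lintegral_mono fun x => ?_
  simp only [Pi.mul_apply]
  gcongr
  exact ENNReal.ofReal_le_ofReal (Literature.Probability.Distributions.gaussianPDFReal_le_peak μ v x)

/-- On the window `|x| ≤ 2√T`, for variances `T/2 ≤ v ≤ T`, the centred Gaussian density is at
least `e^{-4} (2πT)^{-1/2}`. [folklore] -/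
theorem peak_mul_exp_neg_four_le_gaussianPDFReal {T : ℝ} (hT : 0 < T) {v : ℝ≥0}
    (hv1 : T / 2 ≤ v) (hv2 : (v : ℝ) ≤ T) {x : ℝ} (hx : |x| ≤ 2 * √T) :
    (√(2 * Real.pi * T))⁻¹ * Real.exp (-4) ≤ gaussianPDFReal 0 v x := by
  rw [gaussianPDFReal]
  have hvpos : 0 < (v : ℝ) := by linarith
  have hx2 : x ^ 2 ≤ 4 * T := by
    calc x ^ 2 = |x| ^ 2 := (sq_abs x).symm
      _ ≤ (2 * √T) ^ 2 := pow_le_pow_left₀ (abs_nonneg x) hx 2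
      _ = 4 * T := by rw [mul_pow, Real.sq_sqrt hT.le]; norm_num
  have hpi : 0 < Real.pi := Real.pi_pos
  have h1 : (√(2 * Real.pi * T))⁻¹ ≤ (√(2 * Real.pi * v))⁻¹ := by
    apply inv_anti₀ (by positivity)
    exact Real.sqrt_le_sqrt (by nlinarith)
  have h2 : Real.exp (-4) ≤ Real.exp (-(x - 0) ^ 2 / (2 * v)) := by
    rw [Real.exp_le_exp, sub_zero, neg_div, neg_le_neg_iff, div_le_iff₀ (by positivity)]
    nlinarith
  exact mul_le_mul h1 h2 (Real.exp_pos _).le (by positivity)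

/-- Window lower bound for `∫ f dN(0, v)`: if `f` vanishes outside `|x| ≤ 2√T` and
`T/2 ≤ v ≤ T`, then `e^{-4}(2πT)^{-1/2} ∫ f du ≤ ∫ f dN(0, v)`. [folklore] -/
theorem mul_lintegral_le_lintegral_gaussianReal_of_window {T : ℝ} (hT : 0 < T) {v : ℝ≥0}
    (hv1 : T / 2 ≤ v) (hv2 : (v : ℝ) ≤ T) {f : ℝ → ℝ≥0∞} (hf : ∀ x, f x ≠ 0 → |x| ≤ 2 * √T) :
    ENNReal.ofReal ((√(2 * Real.pi * T))⁻¹ * Real.exp (-4)) * ∫⁻ x, f x ≤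
      ∫⁻ x, f x ∂gaussianReal 0 v := by
  have hv : v ≠ 0 := by
    rintro rfl
    simp only [NNReal.coe_zero] at hv1
    linarith
  rw [gaussianReal_of_var_ne_zero 0 hv,
    lintegral_withDensity_eq_lintegral_mul_non_measurable _ (measurable_gaussianPDF 0 v)
      (ae_of_all _ fun _ => gaussianPDF_lt_top) f,
    ← lintegral_const_mul' _ _ ENNReal.ofReal_ne_top]
  refine lintegral_mono fun x => ?_
  simp only [Pi.mul_apply]
  by_cases hx : f x = 0
  · simp [hx]
  · gcongr
    exact ENNReal.ofReal_le_ofReal (peak_mul_exp_neg_four_le_gaussianPDFReal hT hv1 hv2 (hf x hx))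

/-! ### The time integral of the peak -/

/-- `∫_{(0,T]} (2πu)^{-1/2} du = (2π)^{-1/2} · 2√T`. [folklore] -/
theorem lintegral_Ioc_peak {T : ℝ} (hT : 0 < T) :
    ∫⁻ u in Ioc 0 T, ENNReal.ofReal ((√(2 * Real.pi * u))⁻¹) =
      ENNReal.ofReal ((√(2 * Real.pi))⁻¹ * (2 * √T)) := by
  have h : ∀ u ∈ Ioc (0 : ℝ) T, ENNReal.ofReal ((√(2 * Real.pi * u))⁻¹) =
      ENNReal.ofReal ((√(2 * Real.pi))⁻¹) * ENNReal.ofReal ((√u)⁻¹) := by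
    intro u _
    rw [← ENNReal.ofReal_mul (by positivity), Real.sqrt_mul (by positivity), mul_inv]
  rw [setLIntegral_congr_fun measurableSet_Ioc h, lintegral_const_mul _ (by fun_prop),
    setLIntegral_congr Ioo_ae_eq_Ioc.symm, Literature.Analysis.Calculus.lintegral_Ioo_inv_sqrt hT,
    ← ENNReal.ofReal_mul (by positivity)]

/-- Shifted window: for `0 ≤ s`, `∫_{s' ∈ (0,T], s < s'} c(s' − s) ds' ≤ ∫_{(0,T]} c(u) du`
(translation invariance of Lebesgue measure). [folklore] -/
theorem lintegral_Ioc_indicator_shift_le {T s : ℝ} (hs : 0 ≤ s) (c : ℝ → ℝ≥0∞) :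
    ∫⁻ s' in Ioc 0 T, (Ioi s).indicator (fun s' => c (s' - s)) s' ≤ ∫⁻ u in Ioc 0 T, c u := by
  rw [← lintegral_indicator measurableSet_Ioc, ← lintegral_indicator measurableSet_Ioc,
    ← lintegral_sub_right_eq_self (fun u => (Ioc 0 T).indicator c u) s]
  refine lintegral_mono fun s' => ?_
  by_cases h1 : s' ∈ Ioc 0 T
  · by_cases h2 : s' ∈ Ioi s
    · have h3 : s' - s ∈ Ioc 0 T := ⟨sub_pos.2 h2, by linarith [h1.2]⟩
      simp [h1, h2, h3]
    · simp [h1, h2]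
  · simp [h1]

/-! ### Two-time correlation bound for a pre-Brownian motion -/

/-- **Two-time bound.** For a pre-Brownian motion `b`, `s < t` and measurable `f, g ≥ 0`,
`E[f(b_s) g(b_t)] ≤ E[f(b_s)] · (2π(t − s))^{-1/2} ∫ g du`: write `b_t = b_s + (b_t − b_s)` with an
independent `N(0, t − s)` increment and bound its density by the peak.
[cite: ChungZhao1995, §1.1 (1.11)] -/
theorem lintegral_mul_eval_le_of_lt {Ω : Type*} [MeasurableSpace Ω] {P : Measure Ω}
    [IsProbabilityMeasure P] {b : ℝ≥0 → Ω → ℝ} (hb : IsPreBrownianReal b P) {s t : ℝ≥0}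
    (hst : s < t) {f g : ℝ → ℝ≥0∞} (hf : Measurable f) (hg : Measurable g) :
    ∫⁻ ω, f (b s ω) * g (b t ω) ∂P ≤
      (∫⁻ ω, f (b s ω) ∂P) *
        (ENNReal.ofReal ((√(2 * Real.pi * ((t : ℝ) - s)))⁻¹) * ∫⁻ u, g u) := by
  have hind : IndepFun (b s) (b t - b s) P :=
    hb.hasIndepIncrements.indepFun_eval_sub bot_le hst.le hb.eval_zero_ae_eq_zero
  have hlaw : HasLaw (fun ω => (b s ω, (b t - b s) ω))
      ((gaussianReal 0 s).prod (gaussianReal 0 (nndist (t : ℝ) (s : ℝ)))) P :=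
    hind.hasLaw_prod (hb.hasLaw_eval s) (hb.hasLaw_sub t s)
  have hG : Measurable (fun p : ℝ × ℝ => f p.1 * g (p.1 + p.2)) :=
    (hf.comp measurable_fst).mul (hg.comp (measurable_fst.add measurable_snd))
  have e1 : (fun ω => f (b s ω) * g (b t ω)) =
      fun ω => (fun p : ℝ × ℝ => f p.1 * g (p.1 + p.2)) (b s ω, (b t - b s) ω) := by
    ext ω; simp
  rw [e1, hlaw.lintegral_comp hG.aemeasurable, lintegral_prod _ hG.aemeasurable]
  have hst' : (s : ℝ) < t := NNReal.coe_lt_coe.2 hst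
  have hv : nndist (t : ℝ) (s : ℝ) ≠ 0 := by
    rw [ne_eq, nndist_eq_zero]
    exact hst'.ne'
  have hvst : ((nndist (t : ℝ) (s : ℝ) : ℝ≥0) : ℝ) = (t : ℝ) - s := by
    rw [coe_nndist, Real.dist_eq, abs_of_pos (sub_pos.2 hst')]
  calc ∫⁻ x, ∫⁻ y, f x * g (x + y) ∂gaussianReal 0 (nndist (t : ℝ) (s : ℝ)) ∂gaussianReal 0 s
      = ∫⁻ x, f x * ∫⁻ y, g (x + y) ∂gaussianReal 0 (nndist (t : ℝ) (s : ℝ)) ∂gaussianReal 0 s := by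
        refine lintegral_congr fun x => ?_
        have hgx : Measurable fun y => g (x + y) := hg.comp (measurable_const_add x)
        rw [lintegral_const_mul _ hgx]
    _ ≤ ∫⁻ x, f x * (ENNReal.ofReal ((√(2 * Real.pi * ((t : ℝ) - s)))⁻¹) * ∫⁻ u, g u)
          ∂gaussianReal 0 s := by
        refine lintegral_mono fun x => ?_
        gcongr
        calc ∫⁻ y, g (x + y) ∂gaussianReal 0 (nndist (t : ℝ) (s : ℝ))
            ≤ ENNReal.ofReal ((√(2 * Real.pi * (nndist (t : ℝ) (s : ℝ) : ℝ≥0)))⁻¹) *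
                ∫⁻ y, g (x + y) := lintegral_gaussianReal_le_peak_mul 0 hv _
          _ = _ := by rw [lintegral_add_left_eq_self g x, hvst]
    _ = (∫⁻ x, f x ∂gaussianReal 0 s) * _ := lintegral_mul_const _ hf
    _ = _ := by rw [(hb.hasLaw_eval s).lintegral_comp hf.aemeasurable]

/-! ### Square of an integral as twice the integral over the ordered triangle -/

/-- For a measure `ν` on `ℝ` charging no point and measurable `φ ≥ 0`,
`(∫ φ dν)² = 2 ∫ (∫ 𝟙_{s < s'} φ(s) φ(s') dν(s')) dν(s)` (the diagonal is `ν ⊗ ν`-null and the two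
off-diagonal triangles have the same integral by Tonelli). [folklore] -/
theorem lintegral_sq_eq_two_mul_lintegral_indicator (ν : Measure ℝ) [SFinite ν]
    [NullSingletonClass ν] {φ : ℝ → ℝ≥0∞} (hφ : Measurable φ) :
    (∫⁻ s, φ s ∂ν) ^ 2 =
      2 * ∫⁻ s, ∫⁻ s', (Ioi s).indicator (fun s' => φ s * φ s') s' ∂ν ∂ν := by
  have hG : Measurable (fun p : ℝ × ℝ => φ p.1 * φ p.2) :=
    (hφ.comp measurable_fst).mul (hφ.comp measurable_snd)
  have hA : Measurable (fun p : ℝ × ℝ => (Ioi p.1).indicator (fun s' => φ p.1 * φ s') p.2) := by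
    have e : (fun p : ℝ × ℝ => (Ioi p.1).indicator (fun s' => φ p.1 * φ s') p.2) =
        {p : ℝ × ℝ | p.1 < p.2}.indicator (fun p => φ p.1 * φ p.2) := by
      ext p; simp only [Set.indicator, mem_Ioi, mem_setOf_eq]
    rw [e]
    exact hG.indicator (measurableSet_lt measurable_fst measurable_snd)
  have hB : Measurable (fun p : ℝ × ℝ => (Iio p.1).indicator (fun s' => φ p.1 * φ s') p.2) := by
    have e : (fun p : ℝ × ℝ => (Iio p.1).indicator (fun s' => φ p.1 * φ s') p.2) =
        {p : ℝ × ℝ | p.2 < p.1}.indicator (fun p => φ p.1 * φ p.2) := by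
      ext p; simp only [Set.indicator, mem_Iio, mem_setOf_eq]
    rw [e]
    exact hG.indicator (measurableSet_lt measurable_snd measurable_fst)
  calc (∫⁻ s, φ s ∂ν) ^ 2 = ∫⁻ s, ∫⁻ s', φ s * φ s' ∂ν ∂ν := by
        rw [sq, ← lintegral_mul_const _ hφ]
        refine lintegral_congr fun s => ?_
        rw [lintegral_const_mul _ hφ]
    _ = ∫⁻ s, (∫⁻ s', (Ioi s).indicator (fun s' => φ s * φ s') s' ∂ν +
          ∫⁻ s', (Iio s).indicator (fun s' => φ s * φ s') s' ∂ν) ∂ν := by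
        refine lintegral_congr fun s => ?_
        have hAs : Measurable fun s' => (Ioi s).indicator (fun s' => φ s * φ s') s' :=
          hA.comp measurable_prodMk_left
        rw [← lintegral_add_left hAs]
        refine lintegral_congr_ae ?_
        have hne : ∀ᵐ s' ∂ν, s' ≠ s := by
          rw [ae_iff]
          simp only [ne_eq, not_not, setOf_eq_eq_singleton, measure_singleton]
        filter_upwards [hne] with s' hs'
        rcases lt_or_gt_of_ne hs' with h | h
        · have h' : s' ∉ Ioi s := fun h'' => lt_asymm h h''
          simp [h', h, Set.indicator_of_mem, mem_Iio]
        · have h' : s' ∉ Iio s := fun h'' => lt_asymm h h''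
          simp [h', h, Set.indicator_of_mem, mem_Ioi]
    _ = ∫⁻ s, ∫⁻ s', (Ioi s).indicator (fun s' => φ s * φ s') s' ∂ν ∂ν +
          ∫⁻ s, ∫⁻ s', (Iio s).indicator (fun s' => φ s * φ s') s' ∂ν ∂ν :=
        lintegral_add_left hA.lintegral_prod_right' _
    _ = ∫⁻ s, ∫⁻ s', (Ioi s).indicator (fun s' => φ s * φ s') s' ∂ν ∂ν +
          ∫⁻ s, ∫⁻ s', (Ioi s).indicator (fun s' => φ s * φ s') s' ∂ν ∂ν := by
        congr 1
        rw [lintegral_lintegral_swap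
          (f := fun s s' => (Iio s).indicator (fun s' => φ s * φ s') s') hB.aemeasurable]
        refine lintegral_congr fun s' => lintegral_congr fun s => ?_
        by_cases h : s' < s
        · have h1 : s' ∈ Iio s := h
          have h2 : s ∈ Ioi s' := h
          simp only [Set.indicator_of_mem h1, Set.indicator_of_mem h2, mul_comm]
        · have h1 : s' ∉ Iio s := h
          have h2 : s ∉ Ioi s' := h
          simp only [Set.indicator_of_notMem h1, Set.indicator_of_notMem h2]
    _ = 2 * _ := (two_mul _).symm

end Summit.AtomisticToContinuum.BoseEinsteinCondensation.Theorems.CutLineWitness
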